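import Mathlib.Algebra.Order.BigOperators.Group.Finset
import Literature.Barriers.CriticalPhenomena.GridSAWSquareSites
import HarnessLib

/-!
# Barrier `GridSAWCountingSharpPComplete`, squares step: self-avoiding walks of ANY length
# between two vertex images of a drawn graph ↔ abstract simple paths; which drawn edges a
# realised path traverses; degenerate end points; how many simple paths there are

Sibling of `GridSAWUniformDrawingCount.lean` (tower step: walks of the uniform length
`h = ℓ (N - 1)` ↔ Hamiltonian paths, via `realize`/`abstractOf`) and of
`GridSAWSquareSites.lean` (the counting identity of the squares step,
`IsSiteList.ncard_saw_withSquares`: the SAWs of a decorated drawing between non-corner points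
number `Σ_{π ∈ sawFinset (drawnEdges D) a b} 2 ^ #(sitesAlong σ π)`), on the way to the named
sub-fact `LOT2003_thm7_anyLength_squares : GRIDHAMPATHCOUNT ≤ᵖ_{r-shift} SAWCOUNT₄`
(`GridSAWCountingAnyLengthViaGridHamPath.lean`; Liśkiewicz–Ogihara–Toda 2003, Theorem 7 (4)).
To turn that sum into "`Y · 2^{β(N+1)}` plus a smaller term" one needs, for walks of ANY
length: (a) the walks of `drawnEdges D` from `P[s]` to `P[t]` are exactly the realisations of
the abstract simple `s`–`t` paths ("for each simple path `π` in `G′`, let `M(π)` denote the set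
of all SAWs … such that elimination … of all the nodes not corresponding to the nodes of `G′`
produces `π`" [LOT2003, §4, proof of Theorem 7]); (b) which drawn edges the realisation of an
abstract path traverses (so that `#(sitesAlong σ (realize l))` can be computed edge by edge);
(c) the degenerate presentations the string function `GRIDHAMPATHCOUNT` also covers (`s = t`,
an end vertex without incident edge); (d) a bound on the number `η` of non-Hamiltonian simple
paths ("Since `β ≥ N` …"). This file proves all four:

* `absPathsFromTo N D s t` (abstract simple `s`–`t` paths, `IsAbsPath` with prescribed ends;
  finite), `sawFinset_drawnEdges_eq_image_realize`, `injOn_realize_absPathsFromTo`,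
  `card_sawFinset_drawnEdges` and the **weighted form** `sum_sawFinset_drawnEdges_eq`
  (`Σ_{ω} f ω = Σ_{l} f (realize l)`, for `s ≠ t`);
* `listAdj_realize_of_listAdj_path` / `exists_of_listAdj_realize` (the steps of `realize l`
  are exactly the steps of the drawn paths of the edges joining consecutive vertices of `l`),
  `UsedBy l e`, and `countP_usedBy` (a simple path with `m + 1` vertices uses exactly `m` drawn
  edges);
* `sawFinset_self_subset` / `card_sawFinset_self_le_one`, `hamPathCount_self_eq_zero`,
  `hamPathCount_eq_zero_of_isolated_left` / `_right`, `sawFinset_drawnEdges_eq_empty_left` /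
  `_right`, `hamPathCount_eq_card_filter`, `length_lt_of_not_isHamPath`,
  `sawCountAnyLength_translate` (counting from the origin after "shifting the embedding");
* `ncard_nodupLists_le` (`≤ (N + 1) ^ N`) and `ncard_absPathsFromTo_lt_two_pow`
  (`< 2 ^ (N² + 1)`): a degree-free substitute for the printed bound on `η` from maximum
  degree three — any polynomial `β` with `η < 2^β` serves the right shift.

Everything is proved; the only new notions are the set `absPathsFromTo` and the predicate
`UsedBy`.

## References

* M. Liśkiewicz, M. Ogihara, S. Toda, *The complexity of counting self-avoiding walks in
  subgraphs of two-dimensional grids and hypercubes*, TCS 304 (2003) 129–156, §4, proof of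
  Theorem 7 (fourth and fifth types: the sets `M(π)`, the number `η`, "Since `β ≥ N`").
-/

noncomputable section

namespace Literature.Barriers.CriticalPhenomena.GridSAW

open Finset

/-! ### Consecutive pairs under concatenation; vertices of a realised subgraph -/

/-- The consecutive pairs of a concatenation split at the junction point. [folklore] -/
theorem pathEdges_append_cons_split : ∀ (l₁ : List GridPoint) (m : GridPoint) (l₂ : List GridPoint),
    pathEdges (l₁ ++ m :: l₂) = pathEdges (l₁ ++ [m]) ++ pathEdges (m :: l₂)
  | [], m, l₂ => by simp
  | [p], m, l₂ => by simp
  | p :: q :: l₁, m, l₂ => by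
    have ih := pathEdges_append_cons_split (q :: l₁) m l₂
    simp only [List.cons_append, pathEdges_cons_cons] at ih ⊢
    rw [ih]

/-- Adjacency along a concatenation splits at the junction point. [folklore] -/
theorem listAdj_append_cons_iff {l₁ : List GridPoint} {m : GridPoint} {l₂ : List GridPoint}
    {x y : GridPoint} :
    ListAdj (l₁ ++ m :: l₂) x y ↔ ListAdj (l₁ ++ [m]) x y ∨ ListAdj (m :: l₂) x y := by
  unfold ListAdj
  rw [pathEdges_append_cons_split]
  simp only [List.mem_append]
  tauto

/-- Both members of an adjacent pair along `l` belong to `l`. [folklore] -/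
theorem ListAdj.mem_right {l : List GridPoint} {x y : GridPoint} (h : ListAdj l x y) : y ∈ l :=
  h.symm.mem_left

/-- A vertex of a realised subgraph lies on one of the drawn paths. [folklore] -/
theorem exists_mem_path_of_mem_vertexSet {D : List DrawnEdge} {x : GridPoint}
    (hx : x ∈ vertexSet (drawnEdges D)) : ∃ e ∈ D, x ∈ e.2.2 := by
  obtain ⟨f, hf, hfx⟩ := mem_vertexSet_iff.mp hx
  obtain ⟨e, he, hf⟩ := List.mem_flatMap.mp hf
  have hmem := mem_of_mem_pathEdges hf
  rcases hfx with rfl | rfl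
  · exact ⟨e, he, hmem.1⟩
  · exact ⟨e, he, hmem.2⟩

/-! ### Abstract simple paths with prescribed ends -/

/-- The **abstract simple `s`–`t` paths** of the drawn graph on `N` vertices with edges `D`
(vertex lists without repetition, consecutive vertices adjacent, from `s` to `t`).
[cite: LiskiewiczOgiharaToda2003, §4 (proof of Theorem 7: "for each simple path π in G′")] -/
def absPathsFromTo (N : ℕ) (D : List DrawnEdge) (s t : ℕ) : Set (List ℕ) :=
  {l | IsAbsPath N D l ∧ l.head? = some s ∧ l.getLast? = some t}

/-- Unfolding `absPathsFromTo`. [folklore] -/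
@[simp] theorem mem_absPathsFromTo {N : ℕ} {D : List DrawnEdge} {s t : ℕ} {l : List ℕ} :
    l ∈ absPathsFromTo N D s t ↔ IsAbsPath N D l ∧ l.head? = some s ∧ l.getLast? = some t :=
  Iff.rfl

/-- The vertex lists without repetition over `N` vertices form a finite set. [folklore] -/
theorem nodupLists_finite (N : ℕ) : {l : List ℕ | l.Nodup ∧ ∀ v ∈ l, v < N}.Finite := by
  have h := finite_nodup_subset (Finset.range N)
  refine h.subset ?_
  rintro l ⟨hnd, hlt⟩
  exact ⟨hnd, fun v hv => Finset.mem_range.mpr (hlt v hv)⟩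

/-- The abstract simple paths form a finite set. [folklore] -/
theorem absPathsFromTo_finite (N : ℕ) (D : List DrawnEdge) (s t : ℕ) :
    (absPathsFromTo N D s t).Finite :=
  (nodupLists_finite N).subset fun _ h => ⟨h.1.1, h.1.2.1⟩

/-- Hamiltonian paths are the abstract simple `s`–`t` paths through all `N` vertices.
[cite: LiskiewiczOgiharaToda2003, §2.3 (#HamPath)] -/
theorem isHamPath_iff_mem_absPathsFromTo {N : ℕ} {D : List DrawnEdge} {s t : ℕ} {l : List ℕ} :
    IsHamPath N D s t l ↔ l ∈ absPathsFromTo N D s t ∧ l.length = N := by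
  rw [isHamPath_iff, mem_absPathsFromTo]
  tauto

/-- A vertex list without repetition over `N` vertices has at most `N` entries. [folklore] -/
theorem length_le_of_nodup_of_lt {N : ℕ} {l : List ℕ} (hnd : l.Nodup) (hlt : ∀ v ∈ l, v < N) :
    l.length ≤ N := by
  rw [← List.toFinset_card_of_nodup hnd, ← Finset.card_range N]
  exact Finset.card_le_card fun v hv => Finset.mem_range.mpr (hlt v (List.mem_toFinset.mp hv))

/-- An abstract simple path has at most `N` vertices. [folklore] -/
theorem length_le_of_mem_absPathsFromTo {N : ℕ} {D : List DrawnEdge} {s t : ℕ} {l : List ℕ}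
    (h : l ∈ absPathsFromTo N D s t) : l.length ≤ N :=
  length_le_of_nodup_of_lt h.1.1 h.1.2.1

/-- A non-Hamiltonian abstract simple `s`–`t` path has fewer than `N` vertices (at most `N - 2`
edges: "`π` is an `s′`–`t′` path having length at most `N`. Then `π` does not include a
Hamiltonian path"). [cite: LiskiewiczOgiharaToda2003, §4 (proof of Theorem 7, fourth and fifth types)] -/
theorem length_lt_of_not_isHamPath {N : ℕ} {D : List DrawnEdge} {s t : ℕ} {l : List ℕ}
    (h : l ∈ absPathsFromTo N D s t) (hn : ¬ IsHamPath N D s t l) : l.length < N := by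
  have hle := length_le_of_mem_absPathsFromTo h
  rw [isHamPath_iff_mem_absPathsFromTo] at hn
  have hne : l.length ≠ N := fun heq => hn ⟨h, heq⟩
  omega

/-- Hamiltonian paths as a filter of the abstract simple paths. [folklore] -/
theorem hamPathCount_eq_card_filter (N : ℕ) (D : List DrawnEdge) (s t : ℕ) :
    hamPathCount N D s t =
      ((absPathsFromTo_finite N D s t).toFinset.filter fun l => l.length = N).card := by
  rw [hamPathCount, ← Set.ncard_coe_finset]
  congr 1
  ext l
  rw [Set.mem_setOf_eq, Finset.coe_filter, Set.mem_setOf_eq, Set.Finite.mem_toFinset,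
    isHamPath_iff_mem_absPathsFromTo]

/-! ### Degenerate end points -/

/-- From a point to itself there is at most the one-point walk. [folklore] -/
theorem sawFinset_self_subset (E : EdgeList) (a : GridPoint) : sawFinset E a a ⊆ {[a]} := by
  intro ω hω
  obtain ⟨⟨hne, hnd, -, -⟩, hhead, hlast⟩ := mem_sawFinset_iff.mp hω
  rw [Finset.mem_singleton]
  match ω, hne with
  | [x], _ =>
    simp only [List.head?_cons, Option.some.injEq] at hhead
    rw [hhead]
  | x :: y :: l, _ =>
    exfalso
    simp only [List.head?_cons, Option.some.injEq] at hhead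
    subst hhead
    have hmem : (y :: l).getLast (List.cons_ne_nil y l) ∈ y :: l := List.getLast_mem _
    rw [List.getLast?_cons_cons, List.getLast?_eq_some_getLast (List.cons_ne_nil y l),
      Option.some.injEq] at hlast
    rw [hlast] at hmem
    exact (List.nodup_cons.mp hnd).1 hmem

/-- Hence at most one SAW from a point to itself. [folklore] -/
theorem card_sawFinset_self_le_one (E : EdgeList) (a : GridPoint) : (sawFinset E a a).card ≤ 1 :=
  (Finset.card_le_card (sawFinset_self_subset E a)).trans (Finset.card_singleton _).le

/-- For `N ≥ 2` there is no Hamiltonian path from a vertex to itself (such a path is the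
one-vertex list). [folklore] -/
theorem hamPathCount_self_eq_zero {N : ℕ} (D : List DrawnEdge) (hN : 2 ≤ N) (s : ℕ) :
    hamPathCount N D s s = 0 := by
  rw [hamPathCount, Set.ncard_eq_zero (isHamPath_finite N D s s), Set.eq_empty_iff_forall_notMem]
  intro l hl
  obtain ⟨hperm, hhead, hlast, -⟩ := hl
  have hlen : l.length = N := by rw [hperm.length_eq, List.length_range]
  have hnd : l.Nodup := hperm.nodup_iff.mpr List.nodup_range
  match l, hlen with
  | x :: y :: l', _ =>
    simp only [List.head?_cons, Option.some.injEq] at hhead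
    subst hhead
    have hmem : (y :: l').getLast (List.cons_ne_nil y l') ∈ y :: l' := List.getLast_mem _
    rw [List.getLast?_cons_cons, List.getLast?_eq_some_getLast (List.cons_ne_nil y l'),
      Option.some.injEq] at hlast
    rw [hlast] at hmem
    exact (List.nodup_cons.mp hnd).1 hmem
  | [_], h => simp at h; omega
  | [], h => simp at h; omega

/-- **No Hamiltonian path starts at an isolated vertex** (when there are at least two
vertices). [folklore] -/
theorem hamPathCount_eq_zero_of_isolated_left {D : List DrawnEdge} {N : ℕ} (hN : 2 ≤ N) {s : ℕ}
    (hiso : ∀ e ∈ D, e.1 ≠ s ∧ e.2.1 ≠ s) (t : ℕ) : hamPathCount N D s t = 0 := by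
  rw [hamPathCount, Set.ncard_eq_zero (isHamPath_finite N D s t), Set.eq_empty_iff_forall_notMem]
  rintro l ⟨hperm, hhead, -, hch⟩
  have hlen : l.length = N := by rw [hperm.length_eq, List.length_range]
  match l, hlen, hhead with
  | a :: b :: l, _, hhead =>
    simp only [List.head?_cons, Option.some.injEq] at hhead
    subst hhead
    obtain ⟨e, he, hab⟩ := (List.isChain_cons_cons.mp hch).1
    rcases hab with ⟨h, -⟩ | ⟨-, h⟩
    · exact (hiso e he).1 h
    · exact (hiso e he).2 h
  | [_], h, _ => simp at h; omega
  | [], h, _ => simp at h; omega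

/-- **No Hamiltonian path ends at an isolated vertex** (when there are at least two vertices).
[folklore] -/
theorem hamPathCount_eq_zero_of_isolated_right {D : List DrawnEdge} {N : ℕ} (hN : 2 ≤ N) (s : ℕ) {t : ℕ}
    (hiso : ∀ e ∈ D, e.1 ≠ t ∧ e.2.1 ≠ t) : hamPathCount N D s t = 0 := by
  rw [hamPathCount, Set.ncard_eq_zero (isHamPath_finite N D s t), Set.eq_empty_iff_forall_notMem]
  rintro l ⟨hperm, -, hlast, hch⟩
  have hlen : l.length = N := by rw [hperm.length_eq, List.length_range]
  -- read the path backwards: its reverse starts at `t`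
  have hch' : List.IsChain (fun a b => DAdj D b a) l.reverse := List.isChain_reverse.mpr hch
  have hhead' : l.reverse.head? = some t := by rwa [List.head?_reverse]
  have hlen' : l.reverse.length = N := by rw [List.length_reverse, hlen]
  match hl : l.reverse, hlen', hhead' with
  | a :: b :: l', _, hhead' =>
    simp only [List.head?_cons, Option.some.injEq] at hhead'
    subst hhead'
    rw [hl] at hch'
    obtain ⟨e, he, hab⟩ := (List.isChain_cons_cons.mp hch').1
    rcases hab with ⟨-, h⟩ | ⟨h, -⟩
    · exact (hiso e he).2 h
    · exact (hiso e he).1 h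
  | [_], h, _ => simp at h; omega
  | [], h, _ => simp at h; omega

section Drawing

variable {P : List GridPoint} {D : List DrawnEdge}

/-- **An end vertex without incident edge carries no walk**: if no drawn edge ends at `s`, no
SAW of the realised subgraph starts at `P[s]` (that point would lie on a drawn path, hence be
one of its end images). [folklore] -/
theorem sawFinset_drawnEdges_eq_empty_left (hD : IsGridDrawing P D) {s : ℕ} (hs : s < P.length)
    (hiso : ∀ e ∈ D, e.1 ≠ s ∧ e.2.1 ≠ s) (b : GridPoint) : sawFinset (drawnEdges D) P[s] b = ∅ := by
  refine Finset.eq_empty_of_forall_notMem fun ω hω => ?_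
  obtain ⟨⟨-, -, hV, -⟩, hhead, -⟩ := mem_sawFinset_iff.mp hω
  obtain ⟨e, he, hx⟩ := exists_mem_path_of_mem_vertexSet (hV _ (List.mem_of_mem_head? hhead))
  obtain ⟨h1, h2, -, -, -, -, -, hint⟩ := hD.2.1 e he
  rcases hint _ hx (List.getElem_mem hs) with h | h
  · exact (hiso e he).1 ((hD.1.getElem_inj_iff).mp (Option.some.inj
      ((List.getElem?_eq_getElem h1).symm.trans h)))
  · exact (hiso e he).2 ((hD.1.getElem_inj_iff).mp (Option.some.inj
      ((List.getElem?_eq_getElem h2).symm.trans h)))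

/-- The mirror statement for the last point. [folklore] -/
theorem sawFinset_drawnEdges_eq_empty_right (hD : IsGridDrawing P D) {t : ℕ} (ht : t < P.length)
    (hiso : ∀ e ∈ D, e.1 ≠ t ∧ e.2.1 ≠ t) (a : GridPoint) : sawFinset (drawnEdges D) a P[t] = ∅ := by
  refine Finset.eq_empty_of_forall_notMem fun ω hω => ?_
  obtain ⟨⟨-, -, hV, -⟩, -, hlast⟩ := mem_sawFinset_iff.mp hω
  obtain ⟨e, he, hx⟩ := exists_mem_path_of_mem_vertexSet (hV _ (List.mem_of_mem_getLast? hlast))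
  obtain ⟨h1, h2, -, -, -, -, -, hint⟩ := hD.2.1 e he
  rcases hint _ hx (List.getElem_mem ht) with h | h
  · exact (hiso e he).1 ((hD.1.getElem_inj_iff).mp (Option.some.inj
      ((List.getElem?_eq_getElem h1).symm.trans h)))
  · exact (hiso e he).2 ((hD.1.getElem_inj_iff).mp (Option.some.inj
      ((List.getElem?_eq_getElem h2).symm.trans h)))

/-! ### Walks between vertex images are the realisations of the abstract simple paths -/

/-- The realisation of an abstract simple `s`–`t` path with `s ≠ t` is a SAW of `E₀` from
`P[s]` to `P[t]`. [cite: LiskiewiczOgiharaToda2003, §4 (proof of Theorem 7: "every Hamiltonian path of G′ is realized by a path")] -/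
theorem realize_mem_sawFinset (hD : IsGridDrawing P D) {s t : ℕ} (hs : s < P.length)
    (ht : t < P.length) (hst : s ≠ t) {l : List ℕ} (hl : l ∈ absPathsFromTo P.length D s t) :
    realize P D l ∈ sawFinset (drawnEdges D) P[s] P[t] := by
  rw [mem_sawFinset_iff]
  obtain ⟨hpath, hhead, hlast⟩ := hl
  match l, hhead with
  | [a], hhead =>
    simp only [List.head?_cons, Option.some.injEq, List.getLast?_singleton] at hhead hlast
    exact absurd (hhead.symm.trans hlast) hst
  | a :: b :: l, hhead =>
    simp only [List.head?_cons, Option.some.injEq] at hhead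
    rw [hhead] at hpath hlast ⊢
    have hlast' : (s :: b :: l).getLast (List.cons_ne_nil _ _) = t := by
      rw [List.getLast?_eq_some_getLast (List.cons_ne_nil _ _), Option.some.injEq] at hlast
      exact hlast
    refine ⟨⟨List.cons_ne_nil _ _, nodup_realize hD hpath, fun x hx => ?_,
      isChain_realize hD hpath.2.2⟩, ?_, ?_⟩
    · obtain ⟨e, he, hxe⟩ := exists_mem_path_of_mem_realize hD hpath.2.2 x hx
      exact mem_vertexSet_of_mem_path hD he hxe
    · simp [realize, img_eq_getElem hs]
    · rw [getLast?_realize hD hpath.2.2, hlast', img_eq_getElem ht]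

/-- Every SAW of `E₀` from `P[s]` to `P[t]` is the realisation of an abstract simple `s`–`t`
path. [cite: LiskiewiczOgiharaToda2003, §4 (proof of Theorem 7: "elimination from σ of all the nodes not corresponding to the nodes of G′ produces π")] -/
theorem exists_realize_eq_of_mem_sawFinset (hD : IsGridDrawing P D) {s t : ℕ}
    (hs : s < P.length) (ht : t < P.length) {ω : List GridPoint}
    (hω : ω ∈ sawFinset (drawnEdges D) P[s] P[t]) :
    ∃ l ∈ absPathsFromTo P.length D s t, realize P D l = ω := by
  obtain ⟨hsaw, hhead, hlast⟩ := mem_sawFinset_iff.mp hω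
  obtain ⟨l', hpath, hreal⟩ :=
    exists_absPath_realize_eq hD ω.length rfl hsaw.2.2.2 hsaw.2.1 hs hhead ⟨t, ht, hlast⟩
  refine ⟨s :: l', ⟨hpath, rfl, ?_⟩, hreal⟩
  have h1 := getLast?_realize hD hpath.2.2
  rw [hreal, hlast, Option.some.injEq] at h1
  set c := (s :: l').getLast (List.cons_ne_nil _ _) with hc
  have hclt : c < P.length := hpath.2.1 c (List.getLast_mem _)
  rw [img_eq_getElem hclt] at h1
  have hct : t = c := (hD.1.getElem_inj_iff).mp h1
  rw [List.getLast?_eq_some_getLast (List.cons_ne_nil _ _), ← hc, hct]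

/-- **Walks of any length between two distinct vertex images are the realisations of the
abstract simple paths between the vertices.** [cite: LiskiewiczOgiharaToda2003, §4 (proof of Theorem 7, fourth and fifth types: the sets M(π))] -/
theorem sawFinset_drawnEdges_eq_image_realize (hD : IsGridDrawing P D) {s t : ℕ}
    (hs : s < P.length) (ht : t < P.length) (hst : s ≠ t) :
    sawFinset (drawnEdges D) P[s] P[t] =
      (absPathsFromTo_finite P.length D s t).toFinset.image (realize P D) := by
  ext ω
  rw [Finset.mem_image]
  constructor
  · intro h
    obtain ⟨l, hl, hlω⟩ := exists_realize_eq_of_mem_sawFinset hD hs ht h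
    exact ⟨l, (Set.Finite.mem_toFinset _).mpr hl, hlω⟩
  · rintro ⟨l, hl, rfl⟩
    exact realize_mem_sawFinset hD hs ht hst ((Set.Finite.mem_toFinset _).mp hl)

/-- `realize` is injective on the abstract simple `s`–`t` paths (`abstractOf` inverts it).
[folklore] -/
theorem injOn_realize_absPathsFromTo (hD : IsGridDrawing P D) (s t : ℕ) :
    Set.InjOn (realize P D) (absPathsFromTo P.length D s t) := by
  intro l₁ h₁ l₂ h₂ heq
  have hne₁ : l₁ ≠ [] := by rintro rfl; simp at h₁
  have hne₂ : l₂ ≠ [] := by rintro rfl; simp at h₂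
  rw [← abstractOf_realize' hD h₁.1 hne₁, ← abstractOf_realize' hD h₂.1 hne₂, heq]

/-- **Counting form**: for `s ≠ t` the SAWs of `E₀` from `P[s]` to `P[t]` are equinumerous with
the abstract simple `s`–`t` paths. [cite: LiskiewiczOgiharaToda2003, §4 (proof of Theorem 7)] -/
theorem card_sawFinset_drawnEdges (hD : IsGridDrawing P D) {s t : ℕ} (hs : s < P.length)
    (ht : t < P.length) (hst : s ≠ t) :
    (sawFinset (drawnEdges D) P[s] P[t]).card = (absPathsFromTo P.length D s t).ncard := by
  rw [sawFinset_drawnEdges_eq_image_realize hD hs ht hst, Finset.card_image_of_injOn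
    (fun l₁ h₁ l₂ h₂ heq => injOn_realize_absPathsFromTo hD s t ((Set.Finite.mem_toFinset _).mp h₁)
      ((Set.Finite.mem_toFinset _).mp h₂) heq), Set.ncard_eq_toFinset_card _ _]

/-- **Weighted form**: a sum over the SAWs of `E₀` from `P[s]` to `P[t]` (`s ≠ t`) is the sum
over the abstract simple `s`–`t` paths of the summand at their realisations — the shape
"`Σ_π |M(π)|`" of the printed count. [cite: LiskiewiczOgiharaToda2003, §4 (proof of Theorem 7, fifth type: "We evaluate Z₁ as follows")] -/
theorem sum_sawFinset_drawnEdges_eq (hD : IsGridDrawing P D) {s t : ℕ} (hs : s < P.length)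
    (ht : t < P.length) (hst : s ≠ t) (f : List GridPoint → ℕ) :
    ∑ ω ∈ sawFinset (drawnEdges D) P[s] P[t], f ω =
      ∑ l ∈ (absPathsFromTo_finite P.length D s t).toFinset, f (realize P D l) := by
  rw [sawFinset_drawnEdges_eq_image_realize hD hs ht hst, Finset.sum_image]
  intro l₁ h₁ l₂ h₂ heq
  exact injOn_realize_absPathsFromTo hD s t ((Set.Finite.mem_toFinset _).mp h₁)
    ((Set.Finite.mem_toFinset _).mp h₂) heq

/-! ### Steps of a realisation: which drawn edges a realised abstract path traverses -/

/-- **Every step of the drawn path of an edge used by the abstract path is a step of the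
realisation** (in one direction or the other). [folklore] -/
theorem listAdj_realize_of_listAdj_path (hD : IsGridDrawing P D) :
    ∀ {a : ℕ} {l : List ℕ}, List.IsChain (DAdj D) (a :: l) → ∀ {e : DrawnEdge}, e ∈ D →
      ∀ {u v : ℕ}, (u, v) ∈ (a :: l).zip l → HasEnds e u v →
        ∀ {x y : GridPoint}, ListAdj e.2.2 x y → ListAdj (realize P D (a :: l)) x y
  | a, [], _, e, _, u, v, huv, _, x, y, _ => by simp at huv
  | a, b :: l, hch, e, he, u, v, huv, hends, x, y, hxy => by
    obtain ⟨e', he', (hab : HasEnds e' a b)⟩ := (List.isChain_cons_cons.mp hch).1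
    rw [List.zip_cons_cons, List.mem_cons, Prod.mk.injEq] at huv
    rcases huv with ⟨rfl, rfl⟩ | huv
    · rw [realize_cons_cons hD he hends l]
      show ListAdj ((orientedPath e u).dropLast ++ img P v :: realizeTail D v l) x y
      rw [listAdj_append_cons_iff, dropLast_orientedPath_append hD he hends]
      exact Or.inl (listAdj_orientedPath.mpr hxy)
    · rw [realize_cons_cons hD he' hab l]
      show ListAdj ((orientedPath e' a).dropLast ++ img P b :: realizeTail D b l) x y
      rw [listAdj_append_cons_iff]
      exact Or.inr (listAdj_realize_of_listAdj_path hD (List.isChain_cons_cons.mp hch).2 he huv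
        hends hxy)

/-- **Every step of a realisation is a step of the drawn path of an edge joining two
consecutive vertices of the abstract path.** [folklore] -/
theorem exists_of_listAdj_realize (hD : IsGridDrawing P D) :
    ∀ {a : ℕ} {l : List ℕ}, List.IsChain (DAdj D) (a :: l) → ∀ {x y : GridPoint},
      ListAdj (realize P D (a :: l)) x y →
        ∃ uv ∈ (a :: l).zip l, ∃ e ∈ D, HasEnds e uv.1 uv.2 ∧ ListAdj e.2.2 x y
  | a, [], _, x, y, h => by
    rcases h with h | h <;> simp [realize, realizeTail] at h
  | a, b :: l, hch, x, y, h => by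
    obtain ⟨e, he, (hab : HasEnds e a b)⟩ := (List.isChain_cons_cons.mp hch).1
    rw [realize_cons_cons hD he hab l] at h
    change ListAdj ((orientedPath e a).dropLast ++ img P b :: realizeTail D b l) x y at h
    rw [listAdj_append_cons_iff, dropLast_orientedPath_append hD he hab] at h
    rcases h with h | h
    · exact ⟨(a, b), by simp, e, he, hab, listAdj_orientedPath.mp h⟩
    · obtain ⟨uv, huv, e', he', h'⟩ := exists_of_listAdj_realize hD (List.isChain_cons_cons.mp hch).2 h
      exact ⟨uv, by rw [List.zip_cons_cons]; exact List.mem_cons_of_mem _ huv, e', he', h'⟩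

/-- The abstract path `l` **uses** the drawn edge `e`: `e` joins two consecutive vertices of
`l`. [folklore] -/
def UsedBy (l : List ℕ) (e : DrawnEdge) : Prop := ∃ uv ∈ l.zip l.tail, HasEnds e uv.1 uv.2

/-- Decidability of `UsedBy`. [folklore] -/
instance (l : List ℕ) (e : DrawnEdge) : Decidable (UsedBy l e) := by
  unfold UsedBy; infer_instance

/-- `UsedBy` along the first step. [folklore] -/
theorem usedBy_cons_cons_iff {a b : ℕ} {l : List ℕ} {e : DrawnEdge} :
    UsedBy (a :: b :: l) e ↔ HasEnds e a b ∨ UsedBy (b :: l) e := by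
  simp [UsedBy]

/-- A one-vertex path uses no edge. [folklore] -/
theorem not_usedBy_singleton (a : ℕ) (e : DrawnEdge) : ¬ UsedBy [a] e := by
  simp [UsedBy]

/-- Counting a disjoint disjunction. [folklore] -/
theorem countP_or_of_disjoint {α : Type*} (p q : α → Prop) [DecidablePred p] [DecidablePred q] :
    ∀ {l : List α}, (∀ x ∈ l, ¬ (p x ∧ q x)) →
      l.countP (fun x => decide (p x ∨ q x)) = l.countP (fun x => decide (p x)) +
        l.countP (fun x => decide (q x))
  | [], _ => by simp
  | x :: l, h => by
    have ih := countP_or_of_disjoint p q (l := l) fun y hy => h y (List.mem_cons_of_mem _ hy)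
    have hx := h x List.mem_cons_self
    simp only [List.countP_cons, ih]
    by_cases hp : p x <;> by_cases hq : q x <;> simp [hp, hq] at hx ⊢ <;> omega

/-- No drawn edge is repeated in a drawing (an edge has the same ends as itself). [folklore] -/
theorem IsGridDrawing.nodup_edges (hD : IsGridDrawing P D) : D.Nodup :=
  hD.2.2.1.imp fun {e e'} h heq => by subst heq; exact h (Or.inl ⟨rfl, rfl⟩)

/-- In a drawing, exactly one drawn edge joins two adjacent vertices. [folklore] -/
theorem countP_hasEnds_eq_one (hD : IsGridDrawing P D) {a b : ℕ} (hab : DAdj D a b) :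
    D.countP (fun e => decide (HasEnds e a b)) = 1 := by
  obtain ⟨e₀, he₀, (h₀ : HasEnds e₀ a b)⟩ := hab
  rw [List.countP_eq_length_filter]
  have hnd : (D.filter fun e => decide (HasEnds e a b)).Nodup := hD.nodup_edges.filter _
  rw [← List.toFinset_card_of_nodup hnd, Finset.card_eq_one]
  refine ⟨e₀, Finset.eq_singleton_iff_unique_mem.mpr ⟨?_, fun e he => ?_⟩⟩
  · simpa using ⟨he₀, h₀⟩
  · simp only [List.mem_toFinset, List.mem_filter, decide_eq_true_eq] at he
    exact hD.eq_of_hasEnds he.1 he₀ he.2 h₀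

/-- **An abstract simple path with `m + 1` vertices uses exactly `m` drawn edges.**
[cite: LiskiewiczOgiharaToda2003, §4 (proof of Theorem 7: a Hamiltonian path of G′ "is realized by" the paths of its N + 1 edges)] -/
theorem countP_usedBy (hD : IsGridDrawing P D) :
    ∀ {a : ℕ} {l : List ℕ}, IsAbsPath P.length D (a :: l) →
      D.countP (fun e => decide (UsedBy (a :: l) e)) = l.length
  | a, [], _ => by simp [not_usedBy_singleton]
  | a, b :: l, ⟨hnd, hlt, hch⟩ => by
    have hpath' : IsAbsPath P.length D (b :: l) :=
      ⟨hnd.of_cons, fun v hv => hlt v (List.mem_cons_of_mem a hv), (List.isChain_cons_cons.mp hch).2⟩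
    have ih := countP_usedBy hD hpath'
    have ha : a ∉ b :: l := (List.nodup_cons.mp hnd).1
    rw [List.countP_congr (q := fun e => decide (HasEnds e a b ∨ UsedBy (b :: l) e))
        (fun e _ => by simp [usedBy_cons_cons_iff]),
      countP_or_of_disjoint (fun e => HasEnds e a b) (fun e => UsedBy (b :: l) e),
      countP_hasEnds_eq_one hD (List.isChain_cons_cons.mp hch).1, ih, List.length_cons, Nat.add_comm]
    rintro e - ⟨h1, ⟨u, v⟩, huv, h2⟩
    have hu : u ∈ b :: l := (List.of_mem_zip huv).1
    have hv : v ∈ b :: l := List.mem_of_mem_tail (List.of_mem_zip huv).2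
    rcases h1.mem_of_hasEnds h2 with rfl | rfl
    · exact ha hu
    · exact ha hv

end Drawing

/-! ### Counting from the origin -/

/-- `sawCountAnyLength` through `sawFinset`. [folklore] -/
theorem sawCountAnyLength_eq_card_sawFinset (E : EdgeList) (t : GridPoint) :
    sawCountAnyLength E t = (sawFinset E gridOrigin t).card := by
  rw [sawCountAnyLength, ← Set.ncard_coe_finset]
  congr 1
  ext ω
  rw [Finset.mem_coe, mem_sawFinset_iff]
  rfl

/-- **Counting from the origin, any length**: the number of SAWs of `E - a` from the origin to
`b - a` is the number of SAWs of `E` from `a` to `b`.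
[cite: LiskiewiczOgiharaToda2003, §4 (proof of Theorem 7, E₀: "we will shift the embedding accordingly so that s′ is located on (0, 0)")] -/
theorem sawCountAnyLength_translate (E : EdgeList) (a b : GridPoint) :
    sawCountAnyLength (translate (-a) E) (b - a) = (sawFinset E a b).card := by
  rw [sawCountAnyLength, ← Set.ncard_coe_finset]
  have hinj : Function.Injective (List.map fun p : GridPoint => p + -a) :=
    List.map_injective_iff.mpr (add_left_injective _)
  have hset : sawsFromOriginTo (translate (-a) E) (b - a) =
      (List.map fun p : GridPoint => p + -a) '' ↑(sawFinset E a b) := by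
    ext ω'
    simp only [sawsFromOriginTo, Set.mem_setOf_eq, Set.mem_image, Finset.mem_coe, mem_sawFinset_iff]
    constructor
    · rintro ⟨hsaw, hhead, hlast⟩
      refine ⟨ω'.map fun p => p + a, ⟨?_, ?_, ?_⟩, ?_⟩
      · rw [← isSAWIn_translate_iff (-a)]
        simpa [List.map_map, Function.comp_def] using hsaw
      · rw [List.head?_map, hhead]; simp [gridOrigin]
      · rw [List.getLast?_map, hlast]; simp
      · simp [List.map_map, Function.comp_def]
    · rintro ⟨ω, ⟨hsaw, hhead, hlast⟩, rfl⟩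
      refine ⟨(isSAWIn_translate_iff (-a) E ω).mpr hsaw, ?_, ?_⟩
      · rw [List.head?_map, hhead, Option.map_some, add_neg_cancel]; rfl
      · rw [List.getLast?_map, hlast]; simp [sub_eq_add_neg]
  rw [hset, Set.ncard_image_of_injective _ hinj]

/-! ### How many abstract simple paths: a degree-free bound -/

/-- The vertex lists without repetition over `N` vertices, read as the functions
`i ↦ min (l[i]? + 1) N` (`0` past the end) on `Fin N`, inject into `Fin N → Fin (N + 1)`; hence
there are at most `(N + 1) ^ N` of them. [folklore] -/
theorem ncard_nodupLists_le (N : ℕ) :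
    {l : List ℕ | l.Nodup ∧ ∀ v ∈ l, v < N}.ncard ≤ (N + 1) ^ N := by
  classical
  set S := {l : List ℕ | l.Nodup ∧ ∀ v ∈ l, v < N} with hS
  let code : List ℕ → (Fin N → Fin (N + 1)) := fun l i =>
    ⟨min (((l[i.1]?).map (· + 1)).getD 0) N, by omega⟩
  have hcode : ∀ l ∈ S, ∀ i : Fin N,
      ((code l i : Fin (N + 1)) : ℕ) = ((l[i.1]?).map (· + 1)).getD 0 := by
    rintro l ⟨-, hlt⟩ i
    show min _ N = _
    cases h : l[i.1]? with
    | none => simp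
    | some v =>
      have hv : v < N := hlt v (List.mem_of_getElem? h)
      simp only [Option.map_some, Option.getD_some]
      omega
  have hinj : Set.InjOn code S := by
    intro l₁ h₁ l₂ h₂ heq
    have hlen₁ : l₁.length ≤ N := length_le_of_nodup_of_lt h₁.1 h₁.2
    have hlen₂ : l₂.length ≤ N := length_le_of_nodup_of_lt h₂.1 h₂.2
    refine List.ext_getElem? fun i => ?_
    by_cases hi : i < N
    · have h := congrArg (fun c : Fin N → Fin (N + 1) => ((c ⟨i, hi⟩ : Fin (N + 1)) : ℕ)) heq
      rw [hcode l₁ h₁ ⟨i, hi⟩, hcode l₂ h₂ ⟨i, hi⟩] at h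
      cases h₁' : l₁[i]? with
      | none =>
        cases h₂' : l₂[i]? with
        | none => rfl
        | some w => rw [h₁', h₂'] at h; simp at h
      | some v =>
        cases h₂' : l₂[i]? with
        | none => rw [h₁', h₂'] at h; simp at h
        | some w =>
          rw [h₁', h₂'] at h
          simp only [Option.map_some, Option.getD_some, Nat.add_right_cancel_iff] at h
          rw [h]
    · rw [List.getElem?_eq_none (by omega), List.getElem?_eq_none (by omega)]
  calc S.ncard ≤ (Set.univ : Set (Fin N → Fin (N + 1))).ncard :=
        Set.ncard_le_ncard_of_injOn code (fun _ _ => Set.mem_univ _) hinj Set.finite_univ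
    _ = (N + 1) ^ N := by
        rw [Set.ncard_univ, Nat.card_eq_fintype_card, Fintype.card_fun, Fintype.card_fin,
          Fintype.card_fin]

/-- `(N + 1) ^ N ≤ 2 ^ (N * N)` (since `N + 1 ≤ 2 ^ N`). [folklore] -/
theorem succ_pow_self_le_two_pow_mul (N : ℕ) : (N + 1) ^ N ≤ 2 ^ (N * N) := by
  calc (N + 1) ^ N ≤ (2 ^ N) ^ N := Nat.pow_le_pow_left (Nat.lt_two_pow_self) N
    _ = 2 ^ (N * N) := by rw [← pow_mul]

/-- **The abstract simple `s`–`t` paths are fewer than `2 ^ (N * N + 1)`** — so `β = N² + 1`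
attached squares per edge drown all of them below one right shift (the printed choice is
`β = L² ≥ N⁴` with the sharper bound from maximum degree three).
[cite: LiskiewiczOgiharaToda2003, §4 (proof of Theorem 7, fourth type: "Since β ≥ N, the number of SAWs … is [Y · 2^{β(N+1)} + ε]")] -/
theorem ncard_absPathsFromTo_lt_two_pow (N : ℕ) (D : List DrawnEdge) (s t : ℕ) :
    (absPathsFromTo N D s t).ncard < 2 ^ (N * N + 1) := by
  calc (absPathsFromTo N D s t).ncard ≤ {l : List ℕ | l.Nodup ∧ ∀ v ∈ l, v < N}.ncard :=
        Set.ncard_le_ncard (fun _ h => ⟨h.1.1, h.1.2.1⟩) (nodupLists_finite N)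
    _ ≤ (N + 1) ^ N := ncard_nodupLists_le N
    _ ≤ 2 ^ (N * N) := succ_pow_self_le_two_pow_mul N
    _ < 2 ^ (N * N + 1) := Nat.pow_lt_pow_right (by norm_num) (Nat.lt_succ_self _)

/-- The same bound for any sub-family of the abstract paths, as a `Finset` filter (the shape
consumed by `sum_two_pow_mul_div_eq_card`). [folklore] -/
theorem card_filter_absPathsFromTo_lt_two_pow (N : ℕ) (D : List DrawnEdge) (s t : ℕ)
    (p : List ℕ → Prop) [DecidablePred p] :
    ((absPathsFromTo_finite N D s t).toFinset.filter p).card < 2 ^ (N * N + 1) := by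
  calc ((absPathsFromTo_finite N D s t).toFinset.filter p).card
      ≤ (absPathsFromTo_finite N D s t).toFinset.card := Finset.card_filter_le _ _
    _ = (absPathsFromTo N D s t).ncard := (Set.ncard_eq_toFinset_card _ _).symm
    _ < 2 ^ (N * N + 1) := ncard_absPathsFromTo_lt_two_pow N D s t


-- ===== FILE SQUARES (GridSAWSquaresConstruction) =====

end Literature.Barriers.CriticalPhenomena.GridSAW
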